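import Summits.AtomisticToContinuum.HydrodynamicLimit.Theses.GermanoSplitLES
import Literature.MathematicalPhysics.KineticTheory.HardSphereEulerProofs
import HarnessLib

/-!
# Line `BoltzmannEinstein` — checked skeleton for the crux `EntropyTypicality` (stmt-AtomisticToContinuum-9200, route GermanoSplitLES)

Registered skeleton (crux-strategist): THREE stubs `stub_macrostateVolumeBound`, `stub_gibbsVariationalBound`
(`sorry`: the two genuinely open statics) and `stub_tiltDomination` (PROVED here, §1c) — the three sub-cruxes below —
and the sorry-free composition `EntropyTypicality_of`
concluding the route decl `GermanoSplitLES.EntropyTypicality` by name (`EntropyTypicality_of_stubs` applies it to the stubs).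
The same file without the stubs is the item evidence `Split.lean` / the intended Theorems file
`GermanoSplitLESEntropyTypicalitySplit.lean` (Theorems/ is prover-only for this seat).

Crux-strategist decomposition (BC2 redirect) of the pathwise second law in probability
`GermanoSplitLES.EntropyTypicality` into THREE typed pieces along the Boltzmann–Einstein seam
(static statistical mechanics of the invariant measure | explicit tilt of the local Gibbs law):

* `MacrostateVolumeBound` — Boltzmann's macrostate-volume (static large-deviation UPPER) bound under the
  LIOUVILLE measure of `N+1` hard spheres: the phase volume of the configurations whose `G`-coarse-grained
  fields lie in a dilute box and have coarse-grained hard-sphere entropy `< s` is eventually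
  `≤ exp((N+1)(s + 3/2·log(2πe) + γ))`;
* `GibbsVariationalBound` — the Gibbs variational LOWER bound for the local-Gibbs partition function:
  `Z_N ≥ exp((N+1)(S(U) + Λ̄(U) + 3/2·log(2πe) − γ))` eventually, for every continuous dilute competitor
  macrostate `U = (ρ, u, θ)` of unit mass (`Λ̄` the tilt functional of the profiles `(a₀,u₀,θ₀)` at `U`);
* `TiltDomination` — the local Gibbs law is dominated by `Z_N⁻¹ e^{(N+1)c} · Liouville` on the event where
  the initial tilt functional `Λ_N` (an explicit LINEAR functional of the time-`0` empirical fields) is `≤ c`.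

and the sorry-free assembly `EntropyTypicality_of_subs : MacrostateVolumeBound → GibbsVariationalBound →
TiltDomination → EntropyTypicality`: Liouville invariance of the hard-sphere flow for ALL sets (outer
regularity), the law of large numbers of the tilt functional from the time-`0` hypothesis (union bound over
the five empirical fields), the unit-mass dichotomy (`∫ρ₀ ≠ 1` forces `P_N(univ) → 0`), and the exponent
bookkeeping `(Λ̄ + δ/2) + (S̄ − δ + c₀ + δ/8) − (S̄ + Λ̄ + c₀ − δ/8) = −δ/4`.
Support file for stmt-AtomisticToContinuum-9200 (`--supports`); the three `def`s are the children of the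
route edit `--split EntropyTypicality`. [cite: GoldsteinLebowitz2004, §3] [cite: Lanford1973, §A]
-/

noncomputable section

open MeasureTheory Filter Set Topology
open scoped ENNReal

namespace Summit.AtomisticToContinuum.HydrodynamicLimit.Cruxes.EntropyTypicality.BoltzmannEinstein

open Literature.MathematicalPhysics.KineticTheory Literature.Analysis.FluidPDE Literature.Analysis.FunctionSpaces
open Summit.AtomisticToContinuum.HydrodynamicLimit.Theses.GermanoSplitLES

/-! ## §1 The three sub-cruxes (statements; children of the split, route-internal) -/

/-- Sub-crux 1 of the split of `GermanoSplitLES.EntropyTypicality` (route-internal statement, not a cited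
fact): **Boltzmann macrostate-volume bound.** There is a packing band `η₀ > 0` such that for every reduced
diameter `σ > 0`, every fixed continuous kernel `G ≥ 0` with `∫G = 1`, every entropy level `s`, every dilute
box `(c, Cρ, C)` (`0 < c`, `Cρσ³ < η₀`) and every `γ > 0`, eventually in `N` the LIOUVILLE measure
(Lebesgue on `(𝕋³ × ℝ³)^{N+1}` restricted to the hard-sphere domain of diameter `σ(N+1)^{-1/3}`) of the set of
configurations whose `G`-mollified empirical fields lie in the box everywhere and have coarse-grained
hard-sphere entropy `∫ρ_G(3/2 log θ_G − log ρ_G − f_ex(ρ_G σ³)) < s` is at most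
`exp((N+1)(s + 3/2·log(2π) + 3/2 + γ))` (the constant `3/2·log(2πe)` is the Maxwellian velocity entropy
offset; equality in the exponent for the ideal gas with `G ≡ 1`). Static statistical mechanics: no profiles,
no dynamics. -/
def MacrostateVolumeBound : Prop :=
  ∃ η₀ : ℝ, 0 < η₀ ∧ ∀ σ : ℝ, 0 < σ → ∀ G : T3 → ℝ, Continuous G → (∀ x, 0 ≤ G x) → (∫ x, G x = 1) →
    ∀ (s c Cρ C : ℝ), 0 < c → Cρ * σ ^ 3 < η₀ → ∀ γ : ℝ, 0 < γ → ∃ N₀ : ℕ, ∀ N ≥ N₀,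
      Literature.Analysis.FluidPDE.liouville (Literature.Analysis.FluidPDE.Torus.geometry (Fin 3)) (N + 1) (hsDiameter σ N)
        {w | let ρG := fun x => empiricalDensityField w (fun y => G (x - y)); let mG := fun x => empiricalMomentumField w (fun y => G (x - y)); let EG := fun x => empiricalEnergyField w (fun y => G (x - y)); let θG := fun x => 2 / 3 * (EG x / ρG x - ‖mG x‖ ^ 2 / (2 * ρG x ^ 2)); (∀ x, c ≤ ρG x ∧ ρG x ≤ Cρ ∧ ‖mG x‖ ≤ C ∧ EG x ≤ C ∧ c ≤ θG x) ∧ (∫ x, ρG x * (3 / 2 * Real.log (θG x) - Real.log (ρG x) - hsExcessFreeEnergy (ρG x * σ ^ 3))) < s}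
      ≤ ENNReal.ofReal (Real.exp (((N : ℝ) + 1) * (s + 3 / 2 * Real.log (2 * Real.pi) + 3 / 2 + γ)))

/-- Sub-crux 2 of the split of `GermanoSplitLES.EntropyTypicality` (route-internal statement, not a cited
fact): **Gibbs variational lower bound for the local-Gibbs partition function.** There is `η₀ > 0` such that
for all continuous profiles `a₀ > 0`, `θ₀ > 0`, `u₀` there is `σ₀ > 0` with: for `0 < σ < σ₀`, every continuous
competitor macrostate `(ρ > 0, θ > 0, u)` of unit mass `∫ρ = 1` in the dilute band `ρσ³ < η₀`, and every
`γ > 0`, eventually in `N` the canonical partition function `Z_N` of `N+1` hard spheres of diameter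
`σ(N+1)^{-1/3}` with one-particle weight `a₀(x) M_{1,u₀(x),θ₀(x)}(v)` (`canonicalPartition … (localGibbsProfile a₀ u₀ θ₀)`)
satisfies `Z_N ≥ exp((N+1)(S(ρ,u,θ) + Λ̄ + 3/2·log(2π) + 3/2 − γ))`, where
`S = ∫ρ(3/2 log θ − log ρ − f_ex(ρσ³))` is the coarse hard-sphere entropy and
`Λ̄ = ∫αρ + Σ_k (∫(β_k ρ)•u)_k − ∫γ E(ρ,u,θ)` the tilt functional of the profiles at the competitor
(`α = log a₀ − 3/2 log(2πθ₀) − |u₀|²/(2θ₀)`, `β_k = (u₀)_k/θ₀`, `γ = 1/θ₀`, `E = ρ(|u|²/2 + 3θ/2)`; the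
momentum term is written componentwise to match `TendstoHydroFieldsAt`). For `(u,θ) = (u₀,θ₀)` the
exponent is the configurational free-energy functional `∫ρ log a₀ − ∫ρ log ρ − ∫ρ f_ex(ρσ³)`: the LDP
lower-bound half of the Gibbs variational principle in the hydrodynamic (local-density) scaling. -/
def GibbsVariationalBound : Prop :=
  ∃ η₀ : ℝ, 0 < η₀ ∧ ∀ (a₀ θ₀ : T3 → ℝ) (u₀ : T3 → V3), Continuous a₀ → Continuous θ₀ → Continuous u₀ →
    (∀ x, 0 < a₀ x) → (∀ x, 0 < θ₀ x) → ∃ σ₀ : ℝ, 0 < σ₀ ∧ ∀ σ : ℝ, 0 < σ → σ < σ₀ →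
      ∀ (ρ θ : T3 → ℝ) (u : T3 → V3), Continuous ρ → Continuous θ → Continuous u →
        (∀ x, 0 < ρ x) → (∀ x, 0 < θ x) → (∫ x, ρ x = 1) → (∀ x, ρ x * σ ^ 3 < η₀) →
        ∀ γ : ℝ, 0 < γ → ∃ N₀ : ℕ, ∀ N ≥ N₀,
          Real.exp (((N : ℝ) + 1) *
            ((∫ x, ρ x * (3 / 2 * Real.log (θ x) - Real.log (ρ x) - hsExcessFreeEnergy (ρ x * σ ^ 3)))
              + (((∫ x, (Real.log (a₀ x) - 3 / 2 * Real.log (2 * Real.pi * θ₀ x) - ‖u₀ x‖ ^ 2 / (2 * θ₀ x)) * ρ x)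
                  + ∑ k : Fin 3, (∫ x, ((u₀ x) k / θ₀ x * ρ x) • u x) k)
                - ∫ x, (θ₀ x)⁻¹ * totalEnergyDensity (ρ x) (u x) (θ x))
              + 3 / 2 * Real.log (2 * Real.pi) + 3 / 2 - γ))
          ≤ Literature.Analysis.FluidPDE.canonicalPartition (Literature.Analysis.FluidPDE.Torus.geometry (Fin 3)) (hsDiameter σ N) (N + 1) (localGibbsProfile a₀ u₀ θ₀)

/-- Sub-crux 3 of the split of `GermanoSplitLES.EntropyTypicality` (route-internal statement, not a cited
fact; provable now from the definitions, size M): **tilt domination.** For continuous profiles `a₀ > 0`,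
`θ₀ > 0`, `u₀`, every `σ > 0`, `N`, hard-sphere flow `Φ`, set `A` of configurations and level `c`: the local
Gibbs law of `A ∩ {Λ_N(Φ₀ z) ≤ c}` is at most `Z_N⁻¹ · e^{(N+1)c} · Liouville(A)`, where
`Λ_N(w) = ρ_emp(w)(α) + Σ_k (m_emp(w)(β_k))_k − E_emp(w)(γ)` is the initial tilt functional — the density of
the local Gibbs law with respect to the Liouville measure IS `Z_N⁻¹ 1_D exp((N+1)Λ_N)` (product of
`a₀(xᵢ) M_{1,u₀(xᵢ),θ₀(xᵢ)}(vᵢ)`), `Φ₀ = id` Liouville-a.e., and the local Gibbs law is absolutely continuous. -/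
def TiltDomination : Prop :=
  ∀ (a₀ θ₀ : T3 → ℝ) (u₀ : T3 → V3), Continuous a₀ → Continuous θ₀ → Continuous u₀ →
    (∀ x, 0 < a₀ x) → (∀ x, 0 < θ₀ x) → ∀ σ : ℝ, 0 < σ → ∀ (N : ℕ)
      (Φ : Literature.Analysis.FluidPDE.HardSphereFlow (Literature.Analysis.FluidPDE.Torus.geometry (Fin 3)) (hsDiameter σ N) (N + 1))
      (A : Set (Literature.Analysis.FluidPDE.Config (N + 1) (Fin 3) T3)) (c : ℝ),
      localGibbsLaw σ a₀ u₀ θ₀ N Φ (A ∩ {z |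
          empiricalDensityField (Φ.flow 0 z) (fun x => Real.log (a₀ x) - 3 / 2 * Real.log (2 * Real.pi * θ₀ x) - ‖u₀ x‖ ^ 2 / (2 * θ₀ x))
            + (∑ k : Fin 3, (empiricalMomentumField (Φ.flow 0 z) (fun x => (u₀ x) k / θ₀ x)) k)
            - empiricalEnergyField (Φ.flow 0 z) (fun x => (θ₀ x)⁻¹) ≤ c})
        ≤ ENNReal.ofReal ((Literature.Analysis.FluidPDE.canonicalPartition (Literature.Analysis.FluidPDE.Torus.geometry (Fin 3)) (hsDiameter σ N) (N + 1) (localGibbsProfile a₀ u₀ θ₀))⁻¹ * Real.exp (((N : ℝ) + 1) * c))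
          * Literature.Analysis.FluidPDE.liouville (Literature.Analysis.FluidPDE.Torus.geometry (Fin 3)) (N + 1) (hsDiameter σ N) A

/-! ## §1b The registered stubs 1–2 (`sorry` by design; stub 3 is proved in §1c) -/

/-- **stub 1 (hardest, L)** — the Boltzmann macrostate-volume bound (static LDP upper bound under Liouville). -/
theorem stub_macrostateVolumeBound : MacrostateVolumeBound := by
  sorry

/-- **stub 2 (M/L)** — the Gibbs variational lower bound for the local-Gibbs partition function. -/
theorem stub_gibbsVariationalBound : GibbsVariationalBound := by
  sorry

/-! ## §1c Proof of the third stub `TiltDomination` (explicit tilt of the local Gibbs law; no `sorry`) -/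

section Tilt

variable {a₀ θ₀ : T3 → ℝ} {u₀ : T3 → V3}

/-- The initial **tilt functional** `Λ(w) = ρ_emp(α) + Σ_k (m_emp(β_k))_k − E_emp(γ)` of a configuration
(the exponent per particle of the local Gibbs density). [folklore] -/
def tiltFn (a₀ θ₀ : T3 → ℝ) (u₀ : T3 → V3) {n : ℕ} (w : Config n (Fin 3) T3) : ℝ :=
  empiricalDensityField w (fun x => Real.log (a₀ x) - 3 / 2 * Real.log (2 * Real.pi * θ₀ x) - ‖u₀ x‖ ^ 2 / (2 * θ₀ x))
    + (∑ k : Fin 3, (empiricalMomentumField w (fun x => (u₀ x) k / θ₀ x)) k)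
    - empiricalEnergyField w (fun x => (θ₀ x)⁻¹)

/-- The one-particle exponent `ℓ(x,v) = α(x) + Σ_k β_k(x) v_k − γ(x)|v|²/2`. [folklore] -/
def tiltDensity (a₀ θ₀ : T3 → ℝ) (u₀ : T3 → V3) (y : T3 × V3) : ℝ :=
  (Real.log (a₀ y.1) - 3 / 2 * Real.log (2 * Real.pi * θ₀ y.1) - ‖u₀ y.1‖ ^ 2 / (2 * θ₀ y.1))
    + (∑ k : Fin 3, (u₀ y.1) k / θ₀ y.1 * (y.2) k) - (θ₀ y.1)⁻¹ * (‖y.2‖ ^ 2 / 2)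

/-- **The local Gibbs profile is the exponential of the one-particle exponent**:
`a₀(x) M_{1,u₀(x),θ₀(x)}(v) = exp(ℓ(x,v))` for `a₀, θ₀ > 0`. [folklore] -/
theorem localGibbsProfile_eq_exp (hap : ∀ x, 0 < a₀ x) (hθp : ∀ x, 0 < θ₀ x) (y : T3 × V3) :
    localGibbsProfile a₀ u₀ θ₀ y = Real.exp (tiltDensity a₀ θ₀ u₀ y) := by
  obtain ⟨x, v⟩ := y
  have hfin : Module.finrank ℝ V3 = 3 := finrank_euclideanSpace_fin
  have h2πθ : 0 < 2 * Real.pi * θ₀ x := by have := hθp x; positivity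
  simp only [localGibbsProfile, localMaxwellian, tiltDensity, hfin, Nat.cast_ofNat, one_mul]
  rw [Real.rpow_def_of_pos h2πθ, ← Real.exp_add]
  conv_lhs => rw [← Real.exp_log (hap x)]
  rw [← Real.exp_add]
  congr 1
  have hv : ‖v - u₀ x‖ ^ 2 = ∑ k : Fin 3, (v k - (u₀ x) k) ^ 2 := by
    rw [EuclideanSpace.real_norm_sq_eq]
    simp
  have hvv : ‖v‖ ^ 2 = ∑ k : Fin 3, (v k) ^ 2 := EuclideanSpace.real_norm_sq_eq v
  have huu : ‖u₀ x‖ ^ 2 = ∑ k : Fin 3, ((u₀ x) k) ^ 2 := EuclideanSpace.real_norm_sq_eq (u₀ x)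
  rw [hv, hvv, huu]
  simp only [Fin.sum_univ_three]
  have hθ := (hθp x).ne'
  field_simp
  ring

/-- **The tensor power of the profile is `exp((N+1)·Λ)`**: `∏ᵢ a₀(xᵢ)M(vᵢ) = exp(Σᵢ ℓ(zᵢ))` and
`Σᵢ ℓ(zᵢ) = n · Λ(z)`. [folklore] -/
theorem sum_tiltDensity_eq {n : ℕ} (hn : n ≠ 0) (w : Config n (Fin 3) T3) :
    ∑ i, tiltDensity a₀ θ₀ u₀ (w i) = (n : ℝ) * tiltFn a₀ θ₀ u₀ w := by
  have hn' : (n : ℝ) ≠ 0 := Nat.cast_ne_zero.mpr hn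
  simp only [tiltFn, tiltDensity, empiricalDensityField_eq_sum, empiricalMomentumField_eq_sum,
    empiricalEnergyField_eq_sum, PiLp.smul_apply, WithLp.ofLp_sum, WithLp.ofLp_smul, Finset.sum_apply,
    Pi.smul_apply, smul_eq_mul]
  rw [Finset.sum_sub_distrib, Finset.sum_add_distrib, Finset.sum_comm, ← Finset.mul_sum, mul_sub, mul_add,
    ← mul_assoc, ← mul_assoc, ← mul_assoc, mul_inv_cancel₀ hn', one_mul, one_mul, one_mul]

theorem tensorPow_localGibbsProfile_eq_exp (hap : ∀ x, 0 < a₀ x) (hθp : ∀ x, 0 < θ₀ x) {n : ℕ} (hn : n ≠ 0)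
    (w : Config n (Fin 3) T3) :
    tensorPow n (localGibbsProfile a₀ u₀ θ₀) w = Real.exp ((n : ℝ) * tiltFn a₀ θ₀ u₀ w) := by
  rw [← sum_tiltDensity_eq hn, Real.exp_sum]
  exact Finset.prod_congr rfl fun i _ => localGibbsProfile_eq_exp hap hθp (w i)

/-- The one-particle exponent is continuous (`a₀, θ₀ > 0` continuous, `u₀` continuous). [folklore] -/
theorem continuous_tiltDensity (ha : Continuous a₀) (hθ : Continuous θ₀) (hu : Continuous u₀)
    (hap : ∀ x, 0 < a₀ x) (hθp : ∀ x, 0 < θ₀ x) : Continuous (tiltDensity a₀ θ₀ u₀) := by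
  have hθ0 : ∀ y : T3 × V3, θ₀ y.1 ≠ 0 := fun y => (hθp y.1).ne'
  have h1 : Continuous fun y : T3 × V3 => Real.log (a₀ y.1) :=
    (ha.comp continuous_fst).log fun y => (hap y.1).ne'
  have h2 : Continuous fun y : T3 × V3 => Real.log (2 * Real.pi * θ₀ y.1) :=
    (continuous_const.mul (hθ.comp continuous_fst)).log fun y =>
      (mul_pos (mul_pos two_pos Real.pi_pos) (hθp y.1)).ne'
  have h3 : Continuous fun y : T3 × V3 => ‖u₀ y.1‖ ^ 2 / (2 * θ₀ y.1) :=
    ((hu.comp continuous_fst).norm.pow 2).div (continuous_const.mul (hθ.comp continuous_fst)) fun y =>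
      (mul_pos two_pos (hθp y.1)).ne'
  have h4 : ∀ k : Fin 3, Continuous fun y : T3 × V3 => (u₀ y.1) k / θ₀ y.1 * (y.2) k := fun k =>
    ((((EuclideanSpace.proj k).continuous.comp (hu.comp continuous_fst)).div (hθ.comp continuous_fst)
      hθ0).mul ((EuclideanSpace.proj k).continuous.comp continuous_snd))
  have h5 : Continuous fun y : T3 × V3 => (θ₀ y.1)⁻¹ * (‖y.2‖ ^ 2 / 2) :=
    ((hθ.comp continuous_fst).inv₀ hθ0).mul ((continuous_snd.norm.pow 2).div_const 2)
  unfold tiltDensity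
  exact (((h1.sub (continuous_const.mul h2)).sub h3).add (continuous_finset_sum _ fun k _ => h4 k)).sub h5

/-- The tilt functional is a measurable function of the configuration. [folklore] -/
theorem measurable_tiltFn (ha : Continuous a₀) (hθ : Continuous θ₀) (hu : Continuous u₀)
    (hap : ∀ x, 0 < a₀ x) (hθp : ∀ x, 0 < θ₀ x) {n : ℕ} (hn : n ≠ 0) :
    Measurable fun w : Config n (Fin 3) T3 => tiltFn a₀ θ₀ u₀ w := by
  have h : (fun w : Config n (Fin 3) T3 => tiltFn a₀ θ₀ u₀ w) =
      fun w => (n : ℝ)⁻¹ * ∑ i, tiltDensity a₀ θ₀ u₀ (w i) := by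
    funext w
    rw [sum_tiltDensity_eq hn, ← mul_assoc, inv_mul_cancel₀ (Nat.cast_ne_zero.mpr hn), one_mul]
  rw [h]
  exact measurable_const.mul (Finset.measurable_sum _ fun i _ =>
    (continuous_tiltDensity ha hθ hu hap hθp).measurable.comp (measurable_pi_apply i))

/-- **Tilt domination at the level set of `Λ` itself.** For every set `A` and level `c`,
`P_N(A ∩ {Λ(Φ₀ z) ≤ c}) ≤ Z_N⁻¹ e^{(N+1)c} · Liouville(A)`. [folklore] -/
theorem measure_inter_tiltLevel_le (ha : Continuous a₀) (hθ : Continuous θ₀) (hu : Continuous u₀)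
    (hap : ∀ x, 0 < a₀ x) (hθp : ∀ x, 0 < θ₀ x) {σ : ℝ} (N : ℕ)
    (Φ : HardSphereFlow (Torus.geometry (Fin 3)) (hsDiameter σ N) (N + 1))
    (A : Set (Config (N + 1) (Fin 3) T3)) (c : ℝ) :
    localGibbsLaw σ a₀ u₀ θ₀ N Φ (A ∩ {z | tiltFn a₀ θ₀ u₀ (Φ.flow 0 z) ≤ c}) ≤
      ENNReal.ofReal ((canonicalPartition (Torus.geometry (Fin 3)) (hsDiameter σ N) (N + 1)
          (localGibbsProfile a₀ u₀ θ₀))⁻¹ * Real.exp (((N : ℝ) + 1) * c))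
        * liouville (Torus.geometry (Fin 3)) (N + 1) (hsDiameter σ N) A := by
  set Z := canonicalPartition (Torus.geometry (Fin 3)) (hsDiameter σ N) (N + 1) (localGibbsProfile a₀ u₀ θ₀)
    with hZdef
  set K : ℝ≥0∞ := ENNReal.ofReal (Z⁻¹ * Real.exp (((N : ℝ) + 1) * c)) with hKdef
  set D : Set (Config (N + 1) (Fin 3) T3) := hardSphereDomain (Torus.geometry (Fin 3)) (N + 1) (hsDiameter σ N)
    with hDdef
  set S : Set (Config (N + 1) (Fin 3) T3) := {z | tiltFn a₀ θ₀ u₀ z ≤ c} with hSdef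
  set F : Config (N + 1) (Fin 3) T3 → ℝ≥0∞ := fun z => ENNReal.ofReal
    (canonicalDensity (Torus.geometry (Fin 3)) (hsDiameter σ N) (N + 1) (localGibbsProfile a₀ u₀ θ₀) z) with hFdef
  set P := localGibbsLaw σ a₀ u₀ θ₀ N Φ with hPdef
  have hDm : MeasurableSet D := measurableSet_hardSphereDomain _ Torus.measurable_geometry_sepVec _ _
  have hSm : MeasurableSet S :=
    measurableSet_le (measurable_tiltFn ha hθ hu hap hθp (Nat.succ_ne_zero N)) measurable_const
  have hZ0 : 0 ≤ Z := canonicalPartition_nonneg _ _ _ fun y =>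
    localGibbsProfile_nonneg (fun x => (hap x).le) (fun x => (hθp x).le) y
  -- (1) `P ≪ Liouville`, so `Φ₀ = id` P-a.e. and the level set may be taken at `z` itself
  have hPL : P ≪ liouville (Torus.geometry (Fin 3)) (N + 1) (hsDiameter σ N) := by
    rw [hPdef, localGibbsLaw_eq]; exact localGibbsMeasure_absolutelyContinuous σ a₀ u₀ θ₀ N Φ
  have hgood : P Φ.goodᶜ = 0 := hPL Φ.measure_compl_good
  have h1 : P (A ∩ {z | tiltFn a₀ θ₀ u₀ (Φ.flow 0 z) ≤ c}) ≤ P (A ∩ S) := by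
    calc P (A ∩ {z | tiltFn a₀ θ₀ u₀ (Φ.flow 0 z) ≤ c})
        ≤ P (A ∩ {z | tiltFn a₀ θ₀ u₀ (Φ.flow 0 z) ≤ c} ∩ Φ.good) +
            P ((A ∩ {z | tiltFn a₀ θ₀ u₀ (Φ.flow 0 z) ≤ c}) \ Φ.good) := measure_le_inter_add_sdiff _ _ _
      _ ≤ P (A ∩ S) + 0 := by
          refine add_le_add (measure_mono ?_) (le_of_eq (measure_mono_null (sdiff_subset_compl _ _) hgood))
          rintro z ⟨⟨hzA, hzS⟩, hzg⟩
          refine ⟨hzA, ?_⟩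
          rw [mem_setOf_eq, Φ.flow_zero z hzg] at hzS
          exact hzS
      _ = P (A ∩ S) := add_zero _
  refine h1.trans ?_
  -- (2) the density and its pointwise bound on the level set
  have hPw : P = volume.withDensity F := by
    rw [hPdef, localGibbsLaw_eq]; rfl
  have hF : ∀ z, F z ≤ K * D.indicator 1 z + Sᶜ.indicator F z := by
    intro z
    by_cases hzS : z ∈ S
    · have hnot : z ∉ Sᶜ := fun h => h hzS
      rw [indicator_of_notMem hnot, add_zero]
      by_cases hzD : z ∈ D
      · rw [indicator_of_mem hzD, Pi.one_apply, mul_one, hFdef, hKdef]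
        have hden : canonicalDensity (Torus.geometry (Fin 3)) (hsDiameter σ N) (N + 1) (localGibbsProfile a₀ u₀ θ₀) z
            = Z⁻¹ * Real.exp (((N : ℝ) + 1) * tiltFn a₀ θ₀ u₀ z) := by
          rw [Literature.Analysis.FluidPDE.canonicalDensity, ← hZdef, ← hDdef, indicator_of_mem hzD,
            tensorPow_localGibbsProfile_eq_exp hap hθp (Nat.succ_ne_zero N)]
          push_cast
          ring
        refine ENNReal.ofReal_le_ofReal ?_
        rw [hden]
        refine mul_le_mul_of_nonneg_left (Real.exp_le_exp.mpr ?_) (inv_nonneg.mpr hZ0)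
        exact mul_le_mul_of_nonneg_left hzS (by positivity)
      · have h0 : F z = 0 := by
          rw [hFdef]
          simp only [canonicalDensity_eq_zero_of_notMem _ _ _ _ hzD, ENNReal.ofReal_zero]
        rw [h0]
        exact zero_le
    · rw [indicator_of_mem (mem_compl hzS)]
      exact le_add_self
  -- (3) integrate the bound over `A' ∩ S`, `A' ⊇ A` a Liouville-measurable hull of `A`
  set A' : Set (Config (N + 1) (Fin 3) T3) := toMeasurable (liouville (Torus.geometry (Fin 3)) (N + 1) (hsDiameter σ N)) A
    with hA'def
  have hA'm : MeasurableSet A' := measurableSet_toMeasurable _ _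
  have hempty : Sᶜ ∩ (A' ∩ S) = ∅ := by
    ext z
    simp only [mem_inter_iff, mem_compl_iff, mem_empty_iff_false, iff_false, not_and, not_not]
    exact fun h _ => h
  calc P (A ∩ S) ≤ P (A' ∩ S) := measure_mono (inter_subset_inter_left _ (subset_toMeasurable _ _))
    _ = ∫⁻ z in A' ∩ S, F z ∂volume := by rw [hPw, withDensity_apply _ (hA'm.inter hSm)]
    _ ≤ ∫⁻ z in A' ∩ S, (K * D.indicator 1 z + Sᶜ.indicator F z) ∂volume := lintegral_mono fun z => hF z
    _ = K * (volume.restrict (A' ∩ S)) D + ∫⁻ z in A' ∩ S, Sᶜ.indicator F z ∂volume := by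
        rw [lintegral_add_left ((measurable_one.indicator hDm).const_mul K),
          lintegral_const_mul _ (measurable_one.indicator hDm), lintegral_indicator_one hDm]
    _ = K * volume (D ∩ (A' ∩ S)) + 0 := by
        rw [Measure.restrict_apply hDm, lintegral_indicator hSm.compl, Measure.restrict_restrict hSm.compl,
          hempty, Measure.restrict_empty, lintegral_zero_measure]
    _ ≤ K * liouville (Torus.geometry (Fin 3)) (N + 1) (hsDiameter σ N) A' := by
        rw [add_zero, liouville_eq, ← hDdef, Measure.restrict_apply' hDm]
        refine mul_le_mul_left' (measure_mono ?_) _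
        rintro z ⟨hzD, hzA, -⟩
        exact ⟨hzA, hzD⟩
    _ = K * liouville (Torus.geometry (Fin 3)) (N + 1) (hsDiameter σ N) A := by
        rw [hA'def, measure_toMeasurable]

/-- **stub 3 (M) — PROVED**: tilt domination, from the explicit density `Z⁻¹ 1_D exp((N+1)Λ)` of the local Gibbs
law, `Φ₀ = id` a.e., and a Liouville-measurable hull of `A`. -/
theorem stub_tiltDomination : TiltDomination := by
  intro a₀ θ₀ u₀ ha hθ hu hap hθp σ _hσ N Φ A c
  exact measure_inter_tiltLevel_le ha hθ hu hap hθp N Φ A c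

end Tilt

/-! ## §2 Generic lemmas (measure theory / real analysis; no hard-sphere content) -/

/-- **Invariance for ALL sets**: a measure-preserving self-map does not increase the (outer) measure of
preimages, measurable or not (outer regularity via `toMeasurable`). [folklore] -/
theorem measure_preimage_le_of_measurePreserving {α : Type*} [MeasurableSpace α] {μ : Measure α}
    {f : α → α} (hf : MeasurePreserving f μ μ) (s : Set α) : μ (f ⁻¹' s) ≤ μ s :=
  calc μ (f ⁻¹' s) ≤ μ (f ⁻¹' toMeasurable μ s) := measure_mono (preimage_mono (subset_toMeasurable μ s))
    _ = μ (toMeasurable μ s) := hf.measure_preimage (measurableSet_toMeasurable μ s).nullMeasurableSet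
    _ = μ s := measure_toMeasurable s

/-- A coordinate of a difference of vectors of `ℝ³` is bounded by the Euclidean norm. [folklore] -/
theorem abs_apply_sub_apply_le_norm (a b : V3) (k : Fin 3) : |a k - b k| ≤ ‖a - b‖ := by
  have hk : (a k - b k) ^ 2 = ((a - b) k) ^ 2 := by simp
  have h : (a k - b k) ^ 2 ≤ ‖a - b‖ ^ 2 := by
    rw [EuclideanSpace.real_norm_sq_eq, hk]
    exact Finset.single_le_sum (f := fun i => ((a - b) i) ^ 2) (fun i _ => sq_nonneg _) (Finset.mem_univ k)
  exact abs_le_of_sq_le_sq h (norm_nonneg _)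

/-- **Law of large numbers of the tilt functional (union bound).** If three families of real / vector
statistics converge in probability to their centres, then the probability that the linear combination
`D + Σ_k (M_k)_k − E` exceeds its centre by more than `κ` tends to `0`. [folklore] -/
theorem tendsto_measure_compl_tilt {Ω : ℕ → Type*} [∀ N, MeasurableSpace (Ω N)]
    (P : ∀ N, Measure (Ω N)) {D E : ∀ N, Ω N → ℝ} {M : Fin 3 → ∀ N, Ω N → V3}
    {d e : ℝ} {m : Fin 3 → V3}
    (hD : ∀ δ' : ℝ, 0 < δ' → Tendsto (fun N => P N {z | δ' < |D N z - d|}) atTop (𝓝 0))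
    (hM : ∀ k, ∀ δ' : ℝ, 0 < δ' → Tendsto (fun N => P N {z | δ' < ‖M k N z - m k‖}) atTop (𝓝 0))
    (hE : ∀ δ' : ℝ, 0 < δ' → Tendsto (fun N => P N {z | δ' < |E N z - e|}) atTop (𝓝 0))
    {κ : ℝ} (hκ : 0 < κ) :
    Tendsto (fun N => P N {z | D N z + (∑ k : Fin 3, M k N z k) - E N z ≤ d + (∑ k : Fin 3, m k k) - e + κ}ᶜ)
      atTop (𝓝 0) := by
  have hκ5 : 0 < κ / 5 := by positivity
  have hsub : ∀ N, {z | D N z + (∑ k : Fin 3, M k N z k) - E N z ≤ d + (∑ k : Fin 3, m k k) - e + κ}ᶜ ⊆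
      {z | κ / 5 < |D N z - d|} ∪ ((⋃ k, {z | κ / 5 < ‖M k N z - m k‖}) ∪ {z | κ / 5 < |E N z - e|}) := by
    intro N z hz
    rw [mem_compl_iff, mem_setOf_eq, not_le] at hz
    by_contra hcon
    simp only [mem_union, mem_iUnion, mem_setOf_eq, not_or, not_exists, not_lt] at hcon
    obtain ⟨h1, h2, h3⟩ := hcon
    have hk : ∀ k, M k N z k - m k k ≤ κ / 5 := fun k =>
      (le_abs_self _).trans ((abs_apply_sub_apply_le_norm (M k N z) (m k) k).trans (h2 k))
    have hs : (∑ k : Fin 3, M k N z k) - (∑ k : Fin 3, m k k) ≤ 3 * (κ / 5) := by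
      rw [← Finset.sum_sub_distrib]
      calc (∑ k : Fin 3, (M k N z k - m k k)) ≤ ∑ _k : Fin 3, κ / 5 := Finset.sum_le_sum fun k _ => hk k
        _ = 3 * (κ / 5) := by simp
    have h1' := (abs_le.mp h1).2
    have h3' := (abs_le.mp h3).1
    linarith
  have hlim : Tendsto (fun N => P N {z | κ / 5 < |D N z - d|} +
      ((∑ k : Fin 3, P N {z | κ / 5 < ‖M k N z - m k‖}) + P N {z | κ / 5 < |E N z - e|})) atTop (𝓝 0) := by
    have h := (hD _ hκ5).add ((tendsto_finsetSum (Finset.univ : Finset (Fin 3))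
      (fun k _ => hM k _ hκ5)).add (hE _ hκ5))
    simpa using h
  refine tendsto_of_tendsto_of_tendsto_of_le_of_le tendsto_const_nhds hlim (fun _ => zero_le) fun N => ?_
  calc P N _ ≤ P N ({z | κ / 5 < |D N z - d|} ∪
        ((⋃ k, {z | κ / 5 < ‖M k N z - m k‖}) ∪ {z | κ / 5 < |E N z - e|})) := measure_mono (hsub N)
    _ ≤ P N {z | κ / 5 < |D N z - d|} +
        (P N (⋃ k, {z | κ / 5 < ‖M k N z - m k‖}) + P N {z | κ / 5 < |E N z - e|}) :=
        (measure_union_le _ _).trans (add_le_add le_rfl (measure_union_le _ _))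
    _ ≤ P N {z | κ / 5 < |D N z - d|} +
        ((∑ k : Fin 3, P N {z | κ / 5 < ‖M k N z - m k‖}) + P N {z | κ / 5 < |E N z - e|}) := by
        gcongr
        exact measure_iUnion_fintype_le _ _

/-- **The probabilistic skeleton of Boltzmann–Einstein typicality.** If the law `P_N` of the pulled-back
event `Φ_N⁻¹(B_N)` intersected with a good event `S_N` is dominated by `Z_N⁻¹ e^{(N+1)c}` times the
reference measure of the pulled-back event, the reference measure of the pulled-back event is eventually
`≤ e^{(N+1)x}`, the normalisation is eventually `≥ e^{(N+1)y}`, the exponents satisfy `c + x − y < 0`, and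
the bad event `S_Nᶜ` has vanishing probability, then `P_N(Φ_N⁻¹(B_N)) → 0`. [folklore] -/
theorem tendsto_measure_preimage_zero {Ω : ℕ → Type*} [∀ N, MeasurableSpace (Ω N)]
    {P L : ∀ N, Measure (Ω N)} {S B : ∀ N, Set (Ω N)} {f : ∀ N, Ω N → Ω N} {Z : ℕ → ℝ}
    {c x y : ℝ} (N₀ : ℕ)
    (hS : Tendsto (fun N => P N (S N)ᶜ) atTop (𝓝 0))
    (hvol : ∀ N ≥ N₀, L N (f N ⁻¹' B N) ≤ ENNReal.ofReal (Real.exp (((N : ℝ) + 1) * x)))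
    (hZ : ∀ N ≥ N₀, Real.exp (((N : ℝ) + 1) * y) ≤ Z N)
    (hdom : ∀ N ≥ N₀, P N (f N ⁻¹' B N ∩ S N) ≤
      ENNReal.ofReal ((Z N)⁻¹ * Real.exp (((N : ℝ) + 1) * c)) * L N (f N ⁻¹' B N))
    (hr : c + x - y < 0) :
    Tendsto (fun N => P N (f N ⁻¹' B N)) atTop (𝓝 0) := by
  have hr' : 0 < -(c + x - y) := by linarith
  have hexp : Tendsto (fun N : ℕ => ENNReal.ofReal (Real.exp (((N : ℝ) + 1) * (c + x - y)))) atTop (𝓝 0) := by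
    have h1 : Tendsto (fun N : ℕ => ((N : ℝ) + 1) * -(c + x - y)) atTop atTop :=
      (tendsto_natCast_atTop_atTop.atTop_add tendsto_const_nhds).atTop_mul_const hr'
    have h2 := ENNReal.tendsto_ofReal (Real.tendsto_exp_neg_atTop_nhds_zero.comp h1)
    rw [ENNReal.ofReal_zero] at h2
    refine (tendsto_congr fun N => ?_).mp h2
    simp only [Function.comp_apply, mul_neg, neg_neg]
  have hsum : Tendsto (fun N : ℕ => ENNReal.ofReal (Real.exp (((N : ℝ) + 1) * (c + x - y))) + P N (S N)ᶜ)
      atTop (𝓝 0) := by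
    have h := hexp.add hS
    rwa [add_zero] at h
  refine tendsto_of_tendsto_of_tendsto_of_le_of_le' tendsto_const_nhds hsum
    (Eventually.of_forall fun _ => zero_le) ?_
  filter_upwards [eventually_ge_atTop N₀] with N hN
  have hZpos : 0 < Z N := (Real.exp_pos _).trans_le (hZ N hN)
  calc P N (f N ⁻¹' B N) ≤ P N (f N ⁻¹' B N ∩ S N) + P N (f N ⁻¹' B N \ S N) :=
        measure_le_inter_add_sdiff _ _ _
    _ ≤ ENNReal.ofReal (Real.exp (((N : ℝ) + 1) * (c + x - y))) + P N (S N)ᶜ := by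
        gcongr ?_ + ?_
        · calc P N (f N ⁻¹' B N ∩ S N)
              ≤ ENNReal.ofReal ((Z N)⁻¹ * Real.exp (((N : ℝ) + 1) * c)) * L N (f N ⁻¹' B N) := hdom N hN
            _ ≤ ENNReal.ofReal ((Z N)⁻¹ * Real.exp (((N : ℝ) + 1) * c)) *
                  ENNReal.ofReal (Real.exp (((N : ℝ) + 1) * x)) := by
                gcongr
                exact hvol N hN
            _ = ENNReal.ofReal ((Z N)⁻¹ * Real.exp (((N : ℝ) + 1) * c) * Real.exp (((N : ℝ) + 1) * x)) := by
                rw [← ENNReal.ofReal_mul (mul_nonneg (inv_nonneg.mpr hZpos.le) (Real.exp_pos _).le)]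
            _ ≤ ENNReal.ofReal (Real.exp (((N : ℝ) + 1) * (c + x - y))) := by
                apply ENNReal.ofReal_le_ofReal
                have hZinv : (Z N)⁻¹ ≤ Real.exp (-(((N : ℝ) + 1) * y)) := by
                  rw [Real.exp_neg]
                  exact inv_anti₀ (Real.exp_pos _) (hZ N hN)
                calc (Z N)⁻¹ * Real.exp (((N : ℝ) + 1) * c) * Real.exp (((N : ℝ) + 1) * x)
                    ≤ Real.exp (-(((N : ℝ) + 1) * y)) * Real.exp (((N : ℝ) + 1) * c) *
                        Real.exp (((N : ℝ) + 1) * x) := by gcongr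
                  _ = Real.exp (((N : ℝ) + 1) * (c + x - y)) := by
                    rw [← Real.exp_add, ← Real.exp_add]
                    congr 1
                    ring
        · exact measure_mono (sdiff_subset_compl _ _)

/-! ## §3 The assembly -/

/-- **THE GLUE OF THE ROUTE-LEVEL SPLIT: `MacrostateVolumeBound → GibbsVariationalBound → TiltDomination →
EntropyTypicality`.** `η₀ := min η₁ η₂`, `σ₀ := σ₀(profiles)` of the variational bound. Fix the data of
`EntropyTypicality` and `t < T`, `δ, c, Cρ, C`. The time-`0` Euler data `Ū₀ = (ρ,u,θ)(0)` are continuous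
(smooth slices), positive and dilute (the guard at `t = 0`). If `∫ρ(0) ≠ 1` the LLN hypothesis tested
against `χ ≡ 1` forces `P_N(univ) → 0` and the claim is trivial. Otherwise let `S̄ = S(Ū₀)`, `Λ̄ = Λ̄(Ū₀)`
and `S_N = {Λ_N(Φ₀ z) ≤ Λ̄ + δ/2}`: `P_N(S_Nᶜ) → 0` by the LLN of the tilt functional
(`tendsto_measure_compl_tilt` fed with the time-`0` hypothesis at `χ = α, β_k, γ`); the event of
`EntropyTypicality` is the preimage under `Φ_t` of the static macrostate `B_N(S̄ − δ)`, so
`P_N ≤ Z_N⁻¹ e^{(N+1)(Λ̄+δ/2)} · Liouville(Φ_t⁻¹ B_N) + P_N(S_Nᶜ)` (tilt domination),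
`Liouville(Φ_t⁻¹ B_N) ≤ Liouville(B_N) ≤ e^{(N+1)(S̄ − δ + c₀ + δ/8)}` (invariance for all sets, macrostate
volume bound) and `Z_N ≥ e^{(N+1)(S̄ + Λ̄ + c₀ − δ/8)}` (variational bound at the competitor `Ū₀`), whence
the first term is `≤ e^{−(N+1)δ/4} → 0` (`tendsto_measure_preimage_zero`). -/
theorem EntropyTypicality_of (hMVB : MacrostateVolumeBound) (hGVB : GibbsVariationalBound)
    (hTD : TiltDomination) : EntropyTypicality := by
  obtain ⟨η₁, hη₁, H1⟩ := hMVB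
  obtain ⟨η₂, hη₂, H2⟩ := hGVB
  refine ⟨min η₁ η₂, lt_min hη₁ hη₂, ?_⟩
  intro a₀ θ₀ u₀ ha hθ hu hap hθp
  obtain ⟨σ₀, hσ₀, H2σ⟩ := H2 a₀ θ₀ u₀ ha hθ hu hap hθp
  refine ⟨σ₀, hσ₀, ?_⟩
  intro σ hσ hσ₀' T ρ θ u hsol hguard Φ h0 G hG hG0 hG1 t ht δ c Cρ C hδ hc hCρ
  -- the Euler data at time `0`
  have hT : (0 : ℝ) ∈ Ico 0 T := ⟨le_rfl, ht.1.trans_lt ht.2⟩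
  have hρc : Continuous (ρ 0) := (hsol.smooth_density.isSmooth_slice hT).continuous
  have hθc : Continuous (θ 0) := (hsol.smooth_temperature.isSmooth_slice hT).continuous
  have huc : Continuous (u 0) := (hsol.smooth_velocity.isSmooth_slice hT).continuous
  have hρp : ∀ x, 0 < ρ 0 x := hsol.density_pos 0 hT
  have hθp0 : ∀ x, 0 < θ 0 x := hsol.temperature_pos 0 hT
  have hdil : ∀ x, ρ 0 x * σ ^ 3 < η₂ := fun x => (hguard 0 hT x).trans_le (min_le_right _ _)
  have hCρ₁ : Cρ * σ ^ 3 < η₁ := hCρ.trans_le (min_le_left _ _)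
  by_cases hmass : ∫ x, ρ 0 x = 1
  · -- the tilt test functions are continuous
    have hα : Continuous fun x => Real.log (a₀ x) - 3 / 2 * Real.log (2 * Real.pi * θ₀ x) -
        ‖u₀ x‖ ^ 2 / (2 * θ₀ x) :=
      ((ha.log fun x => (hap x).ne').sub
        (continuous_const.mul ((continuous_const.mul hθ).log fun x =>
          (mul_pos (mul_pos two_pos Real.pi_pos) (hθp x)).ne'))).sub
        ((hu.norm.pow 2).div (continuous_const.mul hθ) fun x => (mul_pos two_pos (hθp x)).ne')
    have hβ : ∀ k : Fin 3, Continuous fun x => (u₀ x) k / θ₀ x := fun k =>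
      ((EuclideanSpace.proj k).continuous.comp hu).div hθ fun x => (hθp x).ne'
    have hγ : Continuous fun x => (θ₀ x)⁻¹ := hθ.inv₀ fun x => (hθp x).ne'
    -- LLN of the tilt functional: the bad event has vanishing probability
    have hS := tendsto_measure_compl_tilt (fun N => localGibbsLaw σ a₀ u₀ θ₀ N (Φ N))
      (fun δ' hδ' => (h0 _ hα δ' hδ').1) (fun k δ' hδ' => (h0 _ (hβ k) δ' hδ').2.1)
      (fun δ' hδ' => (h0 _ hγ δ' hδ').2.2) (half_pos hδ)
    -- the two static inputs at γ = δ/8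
    obtain ⟨N₁, hN₁⟩ := H1 σ hσ G hG hG0 hG1
      ((∫ x, ρ 0 x * (3 / 2 * Real.log (θ 0 x) - Real.log (ρ 0 x) - hsExcessFreeEnergy (ρ 0 x * σ ^ 3))) - δ)
      c Cρ C hc hCρ₁ (δ / 8) (by positivity)
    obtain ⟨N₂, hN₂⟩ := H2σ σ hσ hσ₀' (ρ 0) (θ 0) (u 0) hρc hθc huc hρp hθp0 hmass hdil (δ / 8) (by positivity)
    have key := tendsto_measure_preimage_zero (max N₁ N₂) hS
      (fun N hN => (hN₁ N (le_of_max_le_left hN)).trans'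
        (measure_preimage_le_of_measurePreserving ((Φ N).measurePreserving t) _))
      (fun N hN => hN₂ N (le_of_max_le_right hN))
      (fun N _ => hTD a₀ θ₀ u₀ ha hθ hu hap hθp σ hσ N (Φ N) _ _)
      (by linarith)
    exact key
  · -- degenerate mass: the LLN hypothesis at χ ≡ 1 forces `P_N(univ) → 0`
    have hne : 0 < |1 - ∫ x, ρ 0 x| := abs_pos.mpr (sub_ne_zero.mpr (Ne.symm hmass))
    have h1 := (h0 (fun _ => (1 : ℝ)) continuous_const _ (half_pos hne)).1
    refine tendsto_of_tendsto_of_tendsto_of_le_of_le tendsto_const_nhds h1 (fun _ => zero_le)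
      fun N => measure_mono fun z _ => ?_
    rw [mem_setOf_eq, empiricalDensityField_one (Nat.succ_ne_zero N)]
    simp only [one_mul]
    linarith

/-- **The crux from the stubs** (applied form of `EntropyTypicality_of`). -/
theorem EntropyTypicality_of_stubs : EntropyTypicality :=
  EntropyTypicality_of stub_macrostateVolumeBound stub_gibbsVariationalBound stub_tiltDomination

end Summit.AtomisticToContinuum.HydrodynamicLimit.Cruxes.EntropyTypicality.BoltzmannEinstein

end
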